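import Literature.RingTheory.RegularLocalRing.ParameterIdealSocle
import Mathlib.Algebra.Ring.GeomSum
import Mathlib.RingTheory.Finiteness.Ideal
import Mathlib.RingTheory.Localization.AtPrime.Basic
import Mathlib.RingTheory.Localization.Ideal
import Summits.HodgeConjecture.HodgeConjecture.Theorems.PadicSemiregularLiftSemiregularSeedsOnAnchorsJacobianColonEqHelpers
import HarnessLib

/-!
# The transition-determinant colon identity at a regular closed point

Sequel to `…JacobianColonEqHelpers` (stub S1 `stub_jacobianColon_eq` of line `gorenstein-ci-seeds`,
crux `PadicSemiregularLift.SemiregularSeedsOnAnchors`; Villaflor, *Periods of complete intersection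
algebraic cycles*, Rem. 1). The abstract colon identity `((y) : det N) ⊆ (a)` of the previous file
(`mem_span_of_det_mul_mem_span`) asks that every `a_k` be a non-zero-divisor modulo the mixed
ideals `(aᵢ^{L+1} (i ∈ S ∖ k), aⱼ (j ∉ S))`. Here:

* `mem_mixed_of_mul_mem_of_sop` — these hypotheses hold for any `dim P` elements `a₁, …, aₙ` of
  the maximal ideal of a REGULAR LOCAL RING `P` generating an `𝔪`-primary ideal: each mixed ideal
  together with `a_k` is again a parameter ideal, and in a regular local ring the last member of a
  system of parameters is a non-zero-divisor modulo the others (the tree's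
  `Literature.RingTheory.RegularLocalRing.mem_of_mul_mem_of_sop`, Matsumura 17.4).
* `mem_of_mul_mem_of_pow_le` — an `𝔪`-primary ideal (`𝔪` maximal, `𝔪ᴺ ⊆ I`) is saturated with
  respect to the complement of `𝔪`.
* `mem_span_of_det_mul_mem_span_of_isMaximal` — consequently, for a maximal ideal `𝔪` of any
  commutative ring `R` whose local ring `R_𝔪` is regular of dimension `n`, elements
  `a₁, …, aₙ ∈ 𝔪` with `𝔪ᴺ ⊆ (a)`, `y = N a` with all `aᵢ^{L+1} ∈ (y)`:
  `det N · q ∈ (y) ⟹ q ∈ (a)`, i.e. `((y) : det N) = (a)` in `R` itself.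

Everything here is proved.
-/

set_option linter.dupNamespace false

universe u

namespace Summit.HodgeConjecture.HodgeConjecture.Theorems.SemiregularSeedsOnAnchors.GorensteinCiSeeds

open Matrix IsLocalRing

/-! ## Systems of parameters of a regular local ring satisfy the mixed-ideal hypotheses -/

section RegularLocal

variable {P : Type u} [CommRing P] [IsRegularLocalRing P] {ι : Type} [Fintype ι] [DecidableEq ι]

/-- **Mixed parameter ideals.** In a regular local ring `P` of dimension `n = #ι`, let
`a : ι → 𝔪` generate an `𝔪`-primary ideal. Then for `k ∈ S ⊆ ι`, `a_k` is a non-zero-divisor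
modulo `(aᵢ^{L+1} (i ∈ S ∖ k), aⱼ (j ∉ S))`: these `n - 1` elements followed by `a_k` form a
system of parameters. [cite: Matsumura1987, Thm. 17.4 (iii)] -/
theorem mem_mixed_of_mul_mem_of_sop (a : ι → P)
    (hdim : (Fintype.card ι : WithBot ℕ∞) = ringKrullDim P) (hm : ∀ i, a i ∈ maximalIdeal P)
    {N : ℕ} (hN : maximalIdeal P ^ N ≤ Ideal.span (Set.range a)) (L : ℕ) (S : Finset ι) (k : ι)
    (hk : k ∈ S) (w : P)
    (hw : a k * w ∈ Ideal.span ((fun i => a i ^ (L + 1)) '' ↑(S.erase k)) ⊔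
      Ideal.span (a '' (↑S)ᶜ)) :
    w ∈ Ideal.span ((fun i => a i ^ (L + 1)) '' ↑(S.erase k)) ⊔ Ideal.span (a '' (↑S)ᶜ) := by
  classical
  -- the list of the `n - 1` retained parameters
  set B : List P := ((S.erase k).toList.map fun i => a i ^ (L + 1)) ++ (Sᶜ.toList.map a) with hB
  have hofList : Ideal.ofList B =
      Ideal.span ((fun i => a i ^ (L + 1)) '' ↑(S.erase k)) ⊔ Ideal.span (a '' (↑S)ᶜ) := by
    rw [← Ideal.span_union, Ideal.ofList]
    congr 1
    ext x
    simp only [hB, List.mem_append, List.mem_map, Finset.mem_toList, Set.mem_setOf_eq,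
      Set.mem_union, Set.mem_image, Finset.mem_coe, Set.mem_compl_iff, Finset.mem_compl]
  have hlen : ((B ++ [a k]).length : WithBot ℕ∞) = ringKrullDim P := by
    rw [← hdim]
    have h1 : 0 < S.card := Finset.card_pos.mpr ⟨k, hk⟩
    have h2 : S.card ≤ Fintype.card ι := Finset.card_le_univ S
    have : (B ++ [a k]).length = Fintype.card ι := by
      simp only [hB, List.length_append, List.length_map, Finset.length_toList,
        List.length_singleton, Finset.card_erase_of_mem hk, Finset.card_compl]
      omega
    exact_mod_cast this
  have hmB : ∀ q ∈ B ++ [a k], q ∈ maximalIdeal P := by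
    intro q hq
    simp only [hB, List.mem_append, List.mem_map, Finset.mem_toList, List.mem_singleton] at hq
    rcases hq with (⟨i, -, rfl⟩ | ⟨i, -, rfl⟩) | rfl
    · exact Ideal.pow_mem_of_mem _ (hm i) _ (Nat.succ_pos L)
    · exact hm i
    · exact hm k
  -- `(aᵢ^{L+1})ᵢ ⊆ (B, a_k)`, so `(B, a_k)` is `𝔪`-primary
  obtain ⟨M, hM⟩ : ∃ M, Ideal.span (Set.range a) ^ M ≤
      Ideal.span (Set.range fun i => a i ^ (L + 1)) :=
    Ideal.exists_pow_le_of_le_radical_of_fg (Ideal.span_le.mpr (by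
      rintro _ ⟨i, rfl⟩
      exact Ideal.mem_radical_iff.mpr ⟨L + 1, Ideal.subset_span ⟨i, rfl⟩⟩))
      (Submodule.fg_span (Set.finite_range a))
  have hpow : Ideal.span (Set.range fun i => a i ^ (L + 1)) ≤ Ideal.ofList (B ++ [a k]) := by
    rw [Ideal.ofList_append, Ideal.ofList_singleton, hofList, Ideal.span_le]
    rintro _ ⟨i, rfl⟩
    by_cases hiS : i ∈ S
    · by_cases hik : i = k
      · subst hik
        have hi : a i ^ (L + 1) ∈ Ideal.span {a i} :=
          Ideal.pow_mem_of_mem _ (Ideal.mem_span_singleton_self _) _ (Nat.succ_pos L)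
        exact Ideal.mem_sup_right hi
      · have hi : a i ^ (L + 1) ∈ Ideal.span ((fun i => a i ^ (L + 1)) '' ↑(S.erase k)) :=
          Ideal.subset_span ⟨i, Finset.mem_coe.mpr (Finset.mem_erase.mpr ⟨hik, hiS⟩), rfl⟩
        exact Ideal.mem_sup_left (Ideal.mem_sup_left hi)
    · have hi : a i ∈ Ideal.span (a '' (↑S)ᶜ) :=
        Ideal.subset_span ⟨i, fun h => hiS (Finset.mem_coe.mp h), rfl⟩
      exact Ideal.mem_sup_left (Ideal.mem_sup_right (Ideal.pow_mem_of_mem _ hi _ (Nat.succ_pos L)))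
  have hN' : maximalIdeal P ^ (N * M) ≤ Ideal.ofList (B ++ [a k]) := by
    rw [pow_mul]
    exact (Ideal.pow_right_mono hN M).trans (hM.trans hpow)
  have key := Literature.RingTheory.RegularLocalRing.mem_of_mul_mem_of_sop B (a k) hlen hmB hN' w
    (by rwa [hofList])
  rwa [hofList] at key

end RegularLocal

/-! ## Saturation of `𝔪`-primary ideals and descent from the local ring -/

section Descent

variable {R : Type u} [CommRing R]

/-- An `𝔪`-primary ideal is saturated off `𝔪`: if `𝔪` is maximal, `𝔪ᴺ ⊆ I`, `s ∉ 𝔪` and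
`s q ∈ I`, then `q ∈ I` (write `y s + i = 1` with `i ∈ 𝔪`; then `q = q (y s + i)ᴺ ∈ I`).
[folklore] -/
theorem mem_of_mul_mem_of_pow_le {𝔪 I : Ideal R} (h𝔪 : 𝔪.IsMaximal) {N : ℕ} (hN : 𝔪 ^ N ≤ I)
    {s q : R} (hs : s ∉ 𝔪) (h : s * q ∈ I) : q ∈ I := by
  obtain ⟨y, i, hi, hyi⟩ := h𝔪.exists_inv hs
  obtain ⟨t, ht⟩ := sub_dvd_pow_sub_pow (y * s + i) i N
  rw [add_sub_cancel_right, hyi, one_pow] at ht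
  -- `1 - iᴺ = y s t`, so `q = iᴺ q + (y t) (s q)`
  have hq : q = i ^ N * q + y * t * (s * q) := by linear_combination q * ht
  rw [hq]
  exact I.add_mem (I.mul_mem_right _ (hN (Ideal.pow_mem_pow hi N))) (I.mul_mem_left _ h)

/-- **The colon identity in `R`** (Villaflor's Remark 1 in abstract form): let `𝔪 ⊂ R` be a
maximal ideal with `R_𝔪` regular local of dimension `#n`, `a : n → 𝔪` with `𝔪ᴺ ⊆ (a)`,
`y = N a` with `aᵢ^{L+1} ∈ (y)` for all `i`. Then `det N · q ∈ (y) ⟹ q ∈ (a)`; with Cramer,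
`((y) : det N) = (a)`. Proof: in `R_𝔪` the `aᵢ` form a system of parameters, so the mixed-ideal
hypotheses hold (`mem_mixed_of_mul_mem_of_sop`) and `mem_span_of_det_mul_mem_span` gives
`q ∈ (a)R_𝔪`; descend by saturation of the `𝔪`-primary ideal `(a)`.
[cite: Villaflor2022PeriodsCI, Rem 1] -/
theorem mem_span_of_det_mul_mem_span_of_isMaximal :
    ∀ (R : Type u) [CommRing R] (𝔪 : Ideal R) [𝔪.IsMaximal]
      [IsRegularLocalRing (Localization.AtPrime 𝔪)] (n : Type) [Fintype n] [DecidableEq n]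
      (_ : (Fintype.card n : WithBot ℕ∞) = ringKrullDim (Localization.AtPrime 𝔪)) (a : n → R)
      (_ : ∀ i, a i ∈ 𝔪) (N₀ : ℕ) (_ : 𝔪 ^ N₀ ≤ Ideal.span (Set.range a)) (N : Matrix n n R) (L : ℕ)
      (_ : ∀ i, a i ^ (L + 1) ∈ Ideal.span (Set.range (Matrix.mulVec N a))) (q : R)
      (_ : N.det * q ∈ Ideal.span (Set.range (Matrix.mulVec N a))),
      q ∈ Ideal.span (Set.range a) := by
  intro R _ 𝔪 h𝔪 _ n _ _ hdim a ha N₀ hN₀ N L hL q hq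
  -- the data in `P = R_𝔪`
  set a' : n → Localization.AtPrime 𝔪 := algebraMap R (Localization.AtPrime 𝔪) ∘ a with ha'
  set N' : Matrix n n (Localization.AtPrime 𝔪) := N.map (algebraMap R (Localization.AtPrime 𝔪))
    with hN'
  have hy' : N' *ᵥ a' = algebraMap R (Localization.AtPrime 𝔪) ∘ (N *ᵥ a) := by
    ext i
    exact (RingHom.map_mulVec (algebraMap R (Localization.AtPrime 𝔪)) N a i).symm
  have hspan : ∀ v : n → R, Ideal.span (Set.range (algebraMap R (Localization.AtPrime 𝔪) ∘ v)) =
      (Ideal.span (Set.range v)).map (algebraMap R (Localization.AtPrime 𝔪)) := fun v => by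
    rw [Ideal.map_span, Set.range_comp]
  -- `B y = (aᵢ^{L+1})ᵢ`
  choose c hc using fun i => Ideal.mem_span_range_iff_exists_fun.mp (hL i)
  have hB : Matrix.of c *ᵥ (N *ᵥ a) = fun i => a i ^ (L + 1) := by
    ext i
    simp only [Matrix.mulVec, dotProduct, Matrix.of_apply]
    exact hc i
  have hB' : (Matrix.of c).map (algebraMap R (Localization.AtPrime 𝔪)) *ᵥ (N' *ᵥ a') =
      fun i => a' i ^ (L + 1) := by
    ext i
    rw [hy', ← RingHom.map_mulVec (algebraMap R (Localization.AtPrime 𝔪)) (Matrix.of c) (N *ᵥ a) i,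
      hB]
    simp [ha']
  -- the mixed-ideal hypotheses in the regular local ring `P`
  have hm' : ∀ i, a' i ∈ maximalIdeal (Localization.AtPrime 𝔪) := fun i =>
    (IsLocalization.AtPrime.to_map_mem_maximal_iff (Localization.AtPrime 𝔪) 𝔪 (a i)).mpr (ha i)
  have hN₀' : maximalIdeal (Localization.AtPrime 𝔪) ^ N₀ ≤ Ideal.span (Set.range a') := by
    rw [← IsLocalization.AtPrime.map_eq_maximalIdeal 𝔪 (Localization.AtPrime 𝔪), ← Ideal.map_pow,
      ha', hspan]
    exact Ideal.map_mono hN₀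
  have hreg := mem_mixed_of_mul_mem_of_sop a' hdim hm' hN₀' L
  -- `det N' · q ∈ (y')` in `P`
  have hq' : N'.det * algebraMap R (Localization.AtPrime 𝔪) q ∈
      Ideal.span (Set.range (N' *ᵥ a')) := by
    rw [hy', hspan, hN', ← RingHom.mapMatrix_apply, ← RingHom.map_det, ← map_mul]
    exact Ideal.mem_map_of_mem _ hq
  have key := mem_span_of_det_mul_mem_span _ n a' N' _ L hB' hreg _ hq'
  rw [ha', hspan, IsLocalization.algebraMap_mem_map_algebraMap_iff 𝔪.primeCompl] at key
  obtain ⟨s, hs, hsq⟩ := key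
  exact mem_of_mul_mem_of_pow_le h𝔪 hN₀ (Ideal.mem_primeCompl_iff.mp hs) hsq

end Descent

end Summit.HodgeConjecture.HodgeConjecture.Theorems.SemiregularSeedsOnAnchors.GorensteinCiSeeds
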